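import Literature.MathematicalPhysics.QuantumLattice.MatsubaraDeterminantBoundWeighted
import Literature.MathematicalPhysics.QuantumLattice.ChronologicalGramBoundTimes
import HarnessLib

/-!
# The branch-weighted Matsubara-UV determinant bound for arbitrary (unsorted) time labels

Topic `MathematicalPhysics/QuantumLattice`; companion of `MatsubaraDeterminantBoundWeighted` (de Siqueira Pedra–Salmhofer 2008, Thm 2.4 in
mode form with per-mode branch weights — the free propagator at complex chemical potential) in the form consumed by determinant
expansions whose rows and columns carry times in no particular order: the pattern is `t_b < s_a` itself, and the sorting into a staircase
happens inside `norm_det_chronological_le_of_times` (loc. cit. Lemma 3.9).  One theorem,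
**`norm_det_timeOrdered_modes_le_of_branchWeights_of_times`**: `|det| ≤ (2c₀)ⁿ ∏‖F_a‖ ∏‖G_b‖` for all `s, t : Fin n → [0, β]`.

Everything is PROVED (the proof of the staircase version verbatim, closed by the times version of the chronological bound);
no definition, no named fact.

## References

* W. de Siqueira Pedra, M. Salmhofer, Comm. Math. Phys. 282 (2008) 797–818, Thm 2.4, Lemma 3.9, Lemma 4.1. [PedraSalmhofer2008]
-/

noncomputable section

open scoped Matrix ComplexOrder
open Finset NormedSpace Literature.Analysis.Matrix

namespace Literature.MathematicalPhysics.QuantumLattice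

/-- **Branch-weighted mode form, ARBITRARY TIMES** (no pre-sorting): as `norm_det_timeOrdered_modes_le_of_branchWeights` with the
pattern given directly by the times, `t_b < s_a` (creation left of annihilation), for arbitrary `s, t : Fin n → [0, β]`; the rows and
columns are sorted inside `norm_det_chronological_le_of_times`.  **Pedra–Salmhofer's determinant bound in mode form WITH BRANCH WEIGHTS** (de Siqueira Pedra–Salmhofer 2008, Thm 2.4 /
Lemma 4.1 / Cor. 4.2): as `norm_det_timeOrdered_modes_le`, but each mode `m` carries complex constants `cp m` on the
creation-left branch and `cm m` on the other (`‖cp m‖, ‖cm m‖ ≤ c₀`) — the form taken by the time-ordered free propagator at a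
COMPLEX chemical potential `μ + iθ` (`|βθ| ≤ π/4`), whose Fermi factors `(1 + e^{β(d - iθ)})⁻¹` are the real ones times such
constants, and whose phases `e^{iθs}`, `e^{-iθt}` are unimodular row/column factors.  The matrix
`a < k_b ? Σ_m F_a(m) G_b(m) cp_m e^{(s_a-t_b)d_m}/(1+e^{βd_m}) : -Σ_m F_a(m) G_b(m) cm_m e^{(s_a-t_b)d_m}/(1+e^{-βd_m})`
satisfies `|det| ≤ (2c₀)ⁿ ∏_a ‖F_a‖₂ ∏_b ‖G_b‖₂`, uniformly in `β`, the energies and the number of modes (the constants ride on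
the row vectors of the two Gram kernels of `norm_det_chronological_le`). [cite: PedraSalmhofer2008, Thm 2.4 and Lemma 4.1] -/
theorem norm_det_timeOrdered_modes_le_of_branchWeights_of_times {μ : Type*} [Fintype μ] (d : μ → ℝ) (β : ℝ)
    {n : ℕ} (F G : Fin n → μ → ℂ) (cp cm : μ → ℂ) {c₀ : ℝ} (hc₀ : 0 ≤ c₀) (hcp : ∀ m, ‖cp m‖ ≤ c₀) (hcm : ∀ m, ‖cm m‖ ≤ c₀)
    (s t : Fin n → ℝ)
    (hs : ∀ a, 0 ≤ s a ∧ s a ≤ β) (ht : ∀ b, 0 ≤ t b ∧ t b ≤ β) :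
    ‖(Matrix.of fun a b : Fin n =>
        if t b < s a then
          ∑ m, F a m * G b m * cp m *
            ((Real.exp ((s a - t b) * d m) * (1 + Real.exp (β * d m))⁻¹ : ℝ) : ℂ)
        else -∑ m, F a m * G b m * cm m *
            ((Real.exp ((s a - t b) * d m) * (1 + Real.exp (-(β * d m)))⁻¹ : ℝ) : ℂ)).det‖ ≤
      (2 * c₀) ^ n * ((∏ a, Real.sqrt (∑ m, ‖F a m‖ ^ 2)) * ∏ b, Real.sqrt (∑ m, ‖G b m‖ ^ 2)) := by
  classical
  -- weights
  set w : μ → ℝ := fun m => (1 + Real.exp (-(β * |d m|)))⁻¹ with hw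
  have hw0 : ∀ m, 0 ≤ w m := fun m => by positivity
  have hw1 : ∀ m, w m ≤ 1 := fun m => by
    simp only [hw]
    apply inv_le_one_of_one_le₀
    linarith [Real.exp_pos (-(β * |d m|))]
  have hsqw : ∀ m, ((Real.sqrt (w m) : ℝ) : ℂ) * (Real.sqrt (w m) : ℂ) = (w m : ℂ) := fun m => by
    rw [← Complex.ofReal_mul, Real.mul_self_sqrt (hw0 m)]
  -- clocks
  set z₁ : μ → (Fin n ⊕ Fin n) → ℝ :=
    fun m => Sum.elim (fun a => s a - if 0 < d m then β else 0) t with hz₁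
  set z₂ : μ → (Fin n ⊕ Fin n) → ℝ :=
    fun m => Sum.elim s (fun b => t b - if d m < 0 then β else 0) with hz₂
  -- unit Gram vectors of the time kernels, mode by mode
  have hV : ∀ (m : μ) (z : (Fin n ⊕ Fin n) → ℝ), ∃ V : (Fin n ⊕ Fin n) → (Fin n ⊕ Fin n) → ℂ,
      (∀ a b, ∑ r, star (V a r) * V b r = (Real.exp (-(|d m| * |z a - z b|)) : ℂ)) ∧
        ∀ a, ∑ r, ‖V a r‖ ^ 2 = 1 := fun m z =>
    (isPosDefKernel_exp_neg_mul_abs_sub (abs_nonneg (d m))).exists_gram_vectors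
      (fun y => by simp) z
  choose V₁ hV₁ hV₁n using fun m => hV m (z₁ m)
  choose V₂ hV₂ hV₂n using fun m => hV m (z₂ m)
  -- coordinates for `norm_det_chronological_le`
  set u : Fin n → (μ × (Fin n ⊕ Fin n)) → ℂ :=
    fun a x => F a x.1 * cp x.1 * (Real.sqrt (w x.1) : ℂ) * star (V₁ x.1 (Sum.inl a) x.2) with hu
  set v : Fin n → (μ × (Fin n ⊕ Fin n)) → ℂ :=
    fun b x => G b x.1 * (Real.sqrt (w x.1) : ℂ) * V₁ x.1 (Sum.inr b) x.2 with hv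
  set p : Fin n → (μ × (Fin n ⊕ Fin n)) → ℂ :=
    fun a x => F a x.1 * cm x.1 * (Real.sqrt (w x.1) : ℂ) * star (V₂ x.1 (Sum.inl a) x.2) with hp
  set q : Fin n → (μ × (Fin n ⊕ Fin n)) → ℂ :=
    fun b x => -(G b x.1 * (Real.sqrt (w x.1) : ℂ) * V₂ x.1 (Sum.inr b) x.2) with hq
  -- the entries ON the pattern
  have hon : ∀ a b : Fin n, t b < s a → ∑ x, u a x * v b x =
      ∑ m, F a m * G b m * cp m *
        ((Real.exp ((s a - t b) * d m) * (1 + Real.exp (β * d m))⁻¹ : ℝ) : ℂ) := by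
    intro a b hab
    have htsa : t b ≤ s a := hab.le
    rw [Fintype.sum_prod_type]
    refine Finset.sum_congr rfl fun m _ => ?_
    have e1 : ∀ r, u a (m, r) * v b (m, r) = F a m * G b m * cp m * (w m : ℂ) *
        (star (V₁ m (Sum.inl a) r) * V₁ m (Sum.inr b) r) := by
      intro r
      simp only [hu, hv]
      rw [← hsqw m]
      ring
    simp_rw [e1]
    rw [← Finset.mul_sum, hV₁ m, timeKernel_on_eq (d m) β (s a) (t b) htsa (hs a).2 (ht b).1]
    simp only [hz₁, Sum.elim_inl, Sum.elim_inr, hw]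
    push_cast
    ring_nf
  -- the entries OFF the pattern
  have hoff : ∀ a b : Fin n, ¬ t b < s a → ∑ x, p a x * q b x =
      -∑ m, F a m * G b m * cm m *
        ((Real.exp ((s a - t b) * d m) * (1 + Real.exp (-(β * d m)))⁻¹ : ℝ) : ℂ) := by
    intro a b hab
    have hsat : s a ≤ t b := not_lt.1 hab
    rw [Fintype.sum_prod_type, ← Finset.sum_neg_distrib]
    refine Finset.sum_congr rfl fun m _ => ?_
    have e1 : ∀ r, p a (m, r) * q b (m, r) = -(F a m * G b m * cm m * (w m : ℂ) *
        (star (V₂ m (Sum.inl a) r) * V₂ m (Sum.inr b) r)) := by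
      intro r
      simp only [hp, hq]
      rw [← hsqw m]
      ring
    simp_rw [e1]
    rw [Finset.sum_neg_distrib, ← Finset.mul_sum, hV₂ m,
      timeKernel_off_eq (d m) β (s a) (t b) hsat (hs a).1 (ht b).2]
    simp only [hz₂, Sum.elim_inl, Sum.elim_inr, hw]
    push_cast
    ring_nf
  -- the realisation
  have hM : (Matrix.of fun a b : Fin n =>
        if t b < s a then
          ∑ m, F a m * G b m * cp m *
            ((Real.exp ((s a - t b) * d m) * (1 + Real.exp (β * d m))⁻¹ : ℝ) : ℂ)
        else -∑ m, F a m * G b m * cm m *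
            ((Real.exp ((s a - t b) * d m) * (1 + Real.exp (-(β * d m)))⁻¹ : ℝ) : ℂ)) =
      Matrix.of fun a b : Fin n =>
        if t b < s a then ∑ x, u a x * v b x else ∑ x, p a x * q b x := by
    ext a b
    simp only [Matrix.of_apply]
    split_ifs with hab
    · rw [hon a b hab]
    · rw [hoff a b hab]
  rw [hM]
  refine (norm_det_chronological_le_of_times s t u v p q).trans ?_
  -- norms of the coordinates
  have hnu : ∀ a, ∑ x, ‖u a x‖ ^ 2 ≤ c₀ ^ 2 * ∑ m, ‖F a m‖ ^ 2 := by
    intro a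
    rw [Fintype.sum_prod_type, Finset.mul_sum]
    refine Finset.sum_le_sum fun m _ => ?_
    have e1 : ∀ r, ‖u a (m, r)‖ ^ 2 = ‖F a m‖ ^ 2 * ‖cp m‖ ^ 2 * w m * ‖V₁ m (Sum.inl a) r‖ ^ 2 := by
      intro r
      simp only [hu, norm_mul, norm_star, Complex.norm_real, Real.norm_eq_abs,
        abs_of_nonneg (Real.sqrt_nonneg _), mul_pow, Real.sq_sqrt (hw0 m)]
    simp_rw [e1]
    rw [← Finset.mul_sum, hV₁n m, mul_one]
    calc ‖F a m‖ ^ 2 * ‖cp m‖ ^ 2 * w m ≤ ‖F a m‖ ^ 2 * c₀ ^ 2 * 1 :=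
          mul_le_mul (mul_le_mul_of_nonneg_left (pow_le_pow_left₀ (norm_nonneg _) (hcp m) 2) (sq_nonneg _)) (hw1 m) (hw0 m)
            (by positivity)
      _ = c₀ ^ 2 * ‖F a m‖ ^ 2 := by ring
  have hnp : ∀ a, ∑ x, ‖p a x‖ ^ 2 ≤ c₀ ^ 2 * ∑ m, ‖F a m‖ ^ 2 := by
    intro a
    rw [Fintype.sum_prod_type, Finset.mul_sum]
    refine Finset.sum_le_sum fun m _ => ?_
    have e1 : ∀ r, ‖p a (m, r)‖ ^ 2 = ‖F a m‖ ^ 2 * ‖cm m‖ ^ 2 * w m * ‖V₂ m (Sum.inl a) r‖ ^ 2 := by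
      intro r
      simp only [hp, norm_mul, norm_star, Complex.norm_real, Real.norm_eq_abs,
        abs_of_nonneg (Real.sqrt_nonneg _), mul_pow, Real.sq_sqrt (hw0 m)]
    simp_rw [e1]
    rw [← Finset.mul_sum, hV₂n m, mul_one]
    calc ‖F a m‖ ^ 2 * ‖cm m‖ ^ 2 * w m ≤ ‖F a m‖ ^ 2 * c₀ ^ 2 * 1 :=
          mul_le_mul (mul_le_mul_of_nonneg_left (pow_le_pow_left₀ (norm_nonneg _) (hcm m) 2) (sq_nonneg _)) (hw1 m) (hw0 m)
            (by positivity)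
      _ = c₀ ^ 2 * ‖F a m‖ ^ 2 := by ring
  have hnv : ∀ b, ∑ x, ‖v b x‖ ^ 2 ≤ ∑ m, ‖G b m‖ ^ 2 := by
    intro b
    rw [Fintype.sum_prod_type]
    refine Finset.sum_le_sum fun m _ => ?_
    have e1 : ∀ r, ‖v b (m, r)‖ ^ 2 = ‖G b m‖ ^ 2 * w m * ‖V₁ m (Sum.inr b) r‖ ^ 2 := by
      intro r
      simp only [hv, norm_mul, Complex.norm_real, Real.norm_eq_abs,
        abs_of_nonneg (Real.sqrt_nonneg _), mul_pow, Real.sq_sqrt (hw0 m)]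
    simp_rw [e1]
    rw [← Finset.mul_sum, hV₁n m, mul_one]
    exact mul_le_of_le_one_right (by positivity) (hw1 m)
  have hnq : ∀ b, ∑ x, ‖q b x‖ ^ 2 ≤ ∑ m, ‖G b m‖ ^ 2 := by
    intro b
    rw [Fintype.sum_prod_type]
    refine Finset.sum_le_sum fun m _ => ?_
    have e1 : ∀ r, ‖q b (m, r)‖ ^ 2 = ‖G b m‖ ^ 2 * w m * ‖V₂ m (Sum.inr b) r‖ ^ 2 := by
      intro r
      simp only [hq, norm_neg, norm_mul, Complex.norm_real, Real.norm_eq_abs,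
        abs_of_nonneg (Real.sqrt_nonneg _), mul_pow, Real.sq_sqrt (hw0 m)]
    simp_rw [e1]
    rw [← Finset.mul_sum, hV₂n m, mul_one]
    exact mul_le_of_le_one_right (by positivity) (hw1 m)
  -- assemble: `∏ √(‖u‖²+‖p‖²) ≤ (√2)ⁿ ∏ ‖F_a‖`, same for columns
  have hrow : (∏ a, Real.sqrt (∑ x, ‖u a x‖ ^ 2 + ∑ x, ‖p a x‖ ^ 2)) ≤
      (Real.sqrt (2 * c₀ ^ 2)) ^ n * ∏ a, Real.sqrt (∑ m, ‖F a m‖ ^ 2) := by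
    have : (Real.sqrt (2 * c₀ ^ 2)) ^ n * ∏ a, Real.sqrt (∑ m, ‖F a m‖ ^ 2) =
        ∏ a : Fin n, (Real.sqrt (2 * c₀ ^ 2) * Real.sqrt (∑ m, ‖F a m‖ ^ 2)) := by
      rw [Finset.prod_mul_distrib, Finset.prod_const, Finset.card_univ, Fintype.card_fin]
    rw [this]
    refine Finset.prod_le_prod (fun a _ => Real.sqrt_nonneg _) fun a _ => ?_
    rw [← Real.sqrt_mul (by positivity : (0 : ℝ) ≤ 2 * c₀ ^ 2)]
    exact Real.sqrt_le_sqrt (by linarith [hnu a, hnp a])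
  have hcol : (∏ b, Real.sqrt (∑ x, ‖v b x‖ ^ 2 + ∑ x, ‖q b x‖ ^ 2)) ≤
      (Real.sqrt 2) ^ n * ∏ b, Real.sqrt (∑ m, ‖G b m‖ ^ 2) := by
    have : (Real.sqrt 2) ^ n * ∏ b, Real.sqrt (∑ m, ‖G b m‖ ^ 2) =
        ∏ b : Fin n, (Real.sqrt 2 * Real.sqrt (∑ m, ‖G b m‖ ^ 2)) := by
      rw [Finset.prod_mul_distrib, Finset.prod_const, Finset.card_univ, Fintype.card_fin]
    rw [this]
    refine Finset.prod_le_prod (fun b _ => Real.sqrt_nonneg _) fun b _ => ?_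
    rw [← Real.sqrt_mul (by norm_num : (0 : ℝ) ≤ 2)]
    exact Real.sqrt_le_sqrt (by linarith [hnv b, hnq b])
  have hsq : Real.sqrt (2 * c₀ ^ 2) = Real.sqrt 2 * c₀ := by
    rw [Real.sqrt_mul (by norm_num : (0 : ℝ) ≤ 2), Real.sqrt_sq hc₀]
  have h2n : (Real.sqrt (2 * c₀ ^ 2)) ^ n * (Real.sqrt 2) ^ n = (2 * c₀) ^ n := by
    rw [hsq, ← mul_pow]
    congr 1
    calc Real.sqrt 2 * c₀ * Real.sqrt 2 = (Real.sqrt 2 * Real.sqrt 2) * c₀ := by ring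
      _ = 2 * c₀ := by rw [Real.mul_self_sqrt (by norm_num : (0 : ℝ) ≤ 2)]
  have hR0 : 0 ≤ (Real.sqrt (2 * c₀ ^ 2)) ^ n * ∏ a, Real.sqrt (∑ m, ‖F a m‖ ^ 2) := by positivity
  have hcol0 : 0 ≤ ∏ b, Real.sqrt (∑ x, ‖v b x‖ ^ 2 + ∑ x, ‖q b x‖ ^ 2) :=
    Finset.prod_nonneg fun b _ => Real.sqrt_nonneg _
  calc (∏ a, Real.sqrt (∑ x, ‖u a x‖ ^ 2 + ∑ x, ‖p a x‖ ^ 2)) *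
        ∏ b, Real.sqrt (∑ x, ‖v b x‖ ^ 2 + ∑ x, ‖q b x‖ ^ 2)
      ≤ ((Real.sqrt (2 * c₀ ^ 2)) ^ n * ∏ a, Real.sqrt (∑ m, ‖F a m‖ ^ 2)) *
          ((Real.sqrt 2) ^ n * ∏ b, Real.sqrt (∑ m, ‖G b m‖ ^ 2)) := mul_le_mul hrow hcol hcol0 hR0
    _ = (2 * c₀) ^ n * ((∏ a, Real.sqrt (∑ m, ‖F a m‖ ^ 2)) * ∏ b, Real.sqrt (∑ m, ‖G b m‖ ^ 2)) := by
        rw [← h2n]; ring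

end Literature.MathematicalPhysics.QuantumLattice

end
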